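import Summits.NavierStokesRegularity.NavierStokesRegularity.Theorems.CoreGluingGivenInvertibility.Negative.AmbientRotationTiltCalc

/-!
# `CoreGluingGivenInvertibility` (stmt-NavierStokesRegularity-17944) — negative lemma:
# the ambient frame rotation tilts the core Gaussian; the linear input's operator has none

Route `FilamentSkeletonRss`, crux `CoreGluingGivenInvertibility := CoreLinearInvertibility → CoreGluing`
(disprover's file, lands with `--supports stmt-NavierStokesRegularity-17944`; theorems only).

WHAT THE GLUING MEETS.  In the rotating Leray frame the material field is `W = U + ½y − α e₃ × y`.  At the
stagnation point `τ*` of filament `j` (tangent `t`, axial stretching `w′(τ*) = 3/2 + γ`, `γ > 0` by (SC)) the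
cross-sectional velocity gradient is `A⊥ = S − α⟨t,e₃⟩ J`: a symmetric part `S` (the drift `½y` and the
irrotational induction of the other filaments; trace `−γ`, eigenvalues `−(γ/2)(1 ± λ)`) AND the rigid frame
rotation at rate `−α⟨t,e₃⟩`, nonzero on every non-horizontal filament.  After rescaling by `γ` the planar
(`k = 0`) linearised core operator is therefore
`L_λ − ω ∂_θ − R Λ_G`, `ω = −α⟨t,e₃⟩/γ`, `∂_θ = x₀∂₁ − x₁∂₀`,
whereas the crux's hypothesis `CoreLinearInvertibility` (stmt-17973) bounds `T_{λ,R} = L_λ − RΛ_G` — the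
case `ω = 0`.  (`∂_θ G = 0`, so the Gaussian source term `λMG` is unchanged; the OPERATOR is not.)

This file computes, kernel-checked, the effect of `ω` at the level where everything is explicit — the
Gaussian steady states of the local operator `L_λ − ω∂_θ` (`L_λ = strainedVorticityOperator λ`):

* (`Negative/AmbientRotationTiltCalc`: `rotStrainedOp_expNegQuadForm` — closed form on a general centred
  Gaussian `k e^{−(p x₀² + 2r x₀x₁ + s x₁²)}`;)
* `rotStrainedOp_expNegQuadForm_eq_zero_iff` — it is a steady state (`k ≠ 0`) iff
  `p + s = ½`, `r = ω(p − s)`, `4(p² + r²) = (1+λ)p − 2ωr`, `4(r² + s²) = (1−λ)s + 2ωr`;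
* `gaussianCoreRot_unique` — the solution is UNIQUE and explicit:
  `p = ¼ + λ/(4(1+4ω²))`, `s = ¼ − λ/(4(1+4ω²))`, `r = λω/(2(1+4ω²))` (and it does solve the system,
  `gaussianCoreRot_solves`);
* `gaussianCoreRot_untilted_iff` — the steady Gaussian is axis-aligned (`r = 0`) iff `λω = 0`: for every
  filament with `λ ≠ 0` and `⟨t,e₃⟩ ≠ 0` the core Gaussian is TILTED against the strain axes, and a tilted
  Gaussian is never a steady state of the hypothesis' operator `L_λ` (`not_steady_strainedVorticityOperator_of_tilted`);
* `gaussianCoreRot_det` — `ps − r² = (1 + 4ω² − λ²)/(16(1+4ω²))`: a Gaussian core decaying in all cross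
  directions exists iff `λ² < 1 + 4ω²` (`gaussianCoreRot_decaying_iff`).  This is the parent lead's Hurwitz
  criterion `det A⊥ = μ₁μ₂ + α²⟨t,e₃⟩² > 0` (report c2 of stmt-15401) in closed form: frame rotation widens the
  elliptic window `|λ| < 1` of the hypothesis to `|λ| < √(1+4ω²)` and tilts the core; e.g. `λ = 6/5` is
  rescued by `ω = 2/5` but not by `ω = 3/10` (`gaussianCoreRot_examples`; the sibling `C₄` datum,
  `λ ≈ 1.17`, `ω ≈ 0.29`, falls 7 % short, as the lead found: `det A⊥ = −0.022`).

Consequence for provers of stmt-17944 (load-bearing, not a refutation): even at an ELLIPTIC skeleton the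
linear input is the `ω = 0` member of the family of operators the Lyapunov–Schmidt step must invert — at
the one elliptic datum on record, `D*` (`e₀ = (6,3,2)/7`, `α = 1`, `γ ≈ 0.96`), `ω ≈ 0.30 ≠ 0` and
`λ ≈ 0.38 ≠ 0`, so the core Gaussian there is tilted.  Lower bounds `‖T w‖ ≥ c‖w‖` of a non-normal `T`
are not formally stable under the unbounded skew perturbation `−ω∂_θ`, so a proof must either re-derive
the bound for `L_λ − ω∂_θ − RΛ_G` on a compact set of `(λ, ω)` inside `{λ² < 1 + 4ω²}`, or arrange
`⟨t(τ*), e₃⟩ = 0` at every stagnation point (tangent horizontal AT the waist — a codimension-one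
condition; skeletons lying entirely in the horizontal plane are subcritical, `w′ ≡ ½`, by the tree's
`SkeletonEquilibrium/Negative/PlanarSubcritical`, stmt-15400).  Neither is exported by
`SkeletonEquilibrium`.

References: Th. Gallay, Y. Maekawa, arXiv:1610.08384, §4.1 (4.3)–(4.4); H. K. Moffatt, S. Kida,
K. Ohkitani, J. Fluid Mech. 259 (1994) 241–264, §2 (vortex in a general linear background flow).
-/

noncomputable section

namespace Summit.NavierStokesRegularity.NavierStokesRegularity.Theorems.CoreGluingGivenInvertibility.Negative

open Literature.Analysis.FluidPDE
open scoped Laplacian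

set_option linter.dupNamespace false

/-- **Gaussian steady states of `L_λ − ω∂_θ`, classification.**  For `k ≠ 0`, the centred Gaussian
`k e^{−(p x₀² + 2r x₀x₁ + s x₁²)}` solves `L_λ w − ω ∂_θ w = 0` on `ℝ²` iff
`p + s = ½`, `r = ω(p − s)`, `4(p² + r²) = (1+λ)p − 2ωr` and `4(r² + s²) = (1−λ)s + 2ωr`
(evaluate the closed form at `0`, `e₀`, `e₁`, `e₀ + e₁`). [folklore] -/
theorem rotStrainedOp_expNegQuadForm_eq_zero_iff {lam ω p r s k : ℝ} (hk : k ≠ 0) :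
    (∀ x : EuclideanSpace ℝ (Fin 2),
      strainedVorticityOperator lam (fun y : EuclideanSpace ℝ (Fin 2) =>
          k * Real.exp (-(p * y 0 ^ 2 + 2 * r * (y 0 * y 1) + s * y 1 ^ 2))) x -
        ω * (x 0 * fderiv ℝ (fun y : EuclideanSpace ℝ (Fin 2) =>
            k * Real.exp (-(p * y 0 ^ 2 + 2 * r * (y 0 * y 1) + s * y 1 ^ 2))) x
              (EuclideanSpace.single 1 (1 : ℝ)) -
          x 1 * fderiv ℝ (fun y : EuclideanSpace ℝ (Fin 2) =>
            k * Real.exp (-(p * y 0 ^ 2 + 2 * r * (y 0 * y 1) + s * y 1 ^ 2))) x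
              (EuclideanSpace.single 0 (1 : ℝ))) = 0) ↔
      (p + s = 1 / 2 ∧ r = ω * (p - s) ∧ 4 * (p ^ 2 + r ^ 2) = (1 + lam) * p - 2 * ω * r ∧
        4 * (r ^ 2 + s ^ 2) = (1 - lam) * s + 2 * ω * r) := by
  constructor
  · intro h
    have hx : ∀ x : EuclideanSpace ℝ (Fin 2),
        (4 * (p ^ 2 + r ^ 2) - (1 + lam) * p + 2 * ω * r) * x 0 ^ 2 +
          2 * (4 * r * (p + s) - r - ω * (p - s)) * (x 0 * x 1) +
          (4 * (r ^ 2 + s ^ 2) - (1 - lam) * s - 2 * ω * r) * x 1 ^ 2 +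
          (1 - 2 * p - 2 * s) = 0 := by
      intro x
      have h1 := h x
      rw [rotStrainedOp_expNegQuadForm] at h1
      have hne : k * Real.exp (-(p * x 0 ^ 2 + 2 * r * (x 0 * x 1) + s * x 1 ^ 2)) ≠ 0 :=
        mul_ne_zero hk (Real.exp_pos _).ne'
      exact (mul_eq_zero.1 h1).resolve_left hne
    have h0 := hx 0
    have he0 := hx (EuclideanSpace.single 0 (1 : ℝ))
    have he1 := hx (EuclideanSpace.single 1 (1 : ℝ))
    have he2 := hx (EuclideanSpace.single 0 (1 : ℝ) + EuclideanSpace.single 1 (1 : ℝ))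
    simp at h0 he0 he1 he2
    have hT : p + s = 1 / 2 := by linarith
    have hA : 4 * (p ^ 2 + r ^ 2) = (1 + lam) * p - 2 * ω * r := by linarith
    have hB : 4 * (r ^ 2 + s ^ 2) = (1 - lam) * s + 2 * ω * r := by linarith
    have hC : 4 * r * (p + s) - r - ω * (p - s) = 0 := by nlinarith
    refine ⟨hT, ?_, hA, hB⟩
    rw [hT] at hC
    linarith
  · rintro ⟨hT, hC, hA, hB⟩ x
    rw [rotStrainedOp_expNegQuadForm]
    have h1 : 4 * (p ^ 2 + r ^ 2) - (1 + lam) * p + 2 * ω * r = 0 := by linarith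
    have h2 : 4 * (r ^ 2 + s ^ 2) - (1 - lam) * s - 2 * ω * r = 0 := by linarith
    have h3 : 4 * r * (p + s) - r - ω * (p - s) = 0 := by rw [hT, hC]; ring
    have h4 : 1 - 2 * p - 2 * s = 0 := by linarith
    rw [h1, h2, h3, h4]
    ring

/-- **Uniqueness and closed form of the core Gaussian with ambient rotation.**  The algebraic system of
`rotStrainedOp_expNegQuadForm_eq_zero_iff` has exactly one solution:
`p = ¼ + (λ/4)(1+4ω²)⁻¹`, `s = ¼ − (λ/4)(1+4ω²)⁻¹`, `r = (λω/2)(1+4ω²)⁻¹`. [folklore] -/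
theorem gaussianCoreRot_unique {lam ω p r s : ℝ}
    (h : p + s = 1 / 2 ∧ r = ω * (p - s) ∧ 4 * (p ^ 2 + r ^ 2) = (1 + lam) * p - 2 * ω * r ∧
      4 * (r ^ 2 + s ^ 2) = (1 - lam) * s + 2 * ω * r) :
    p = 1 / 4 + lam / 4 * (1 + 4 * ω ^ 2)⁻¹ ∧ s = 1 / 4 - lam / 4 * (1 + 4 * ω ^ 2)⁻¹ ∧
      r = lam * ω / 2 * (1 + 4 * ω ^ 2)⁻¹ := by
  obtain ⟨hT, hC, hA, hB⟩ := h
  have hω : (0 : ℝ) < 1 + 4 * ω ^ 2 := by positivity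
  -- subtracting the two quadratic equations and using `p + s = ½`, `r = ω(p − s)`:
  have hd : (p - s) * (1 + 4 * ω ^ 2) = lam / 2 := by
    have e1 : 4 * (p ^ 2 - s ^ 2) = (1 + lam) * p - (1 - lam) * s - 4 * ω * r := by linarith
    have e2 : 4 * (p ^ 2 - s ^ 2) = 2 * (p - s) := by
      have : p ^ 2 - s ^ 2 = (p - s) * (p + s) := by ring
      rw [this, hT]; ring
    have e3 : (1 + lam) * p - (1 - lam) * s = (p - s) + lam * (p + s) := by ring
    rw [e3, hT, hC] at e1
    nlinarith
  have hd' : p - s = lam / 2 * (1 + 4 * ω ^ 2)⁻¹ :=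
    (eq_mul_inv_iff_mul_eq₀ hω.ne').2 hd
  refine ⟨?_, ?_, ?_⟩
  · have : p = ((p + s) + (p - s)) / 2 := by ring
    rw [this, hT, hd']
    ring
  · have : s = ((p + s) - (p - s)) / 2 := by ring
    rw [this, hT, hd']
    ring
  · rw [hC, hd']
    ring

/-- … and that triple does solve the system (existence; `c = (1+4ω²)⁻¹`). [folklore] -/
theorem gaussianCoreRot_solves (lam ω : ℝ) :
    (1 / 4 + lam / 4 * (1 + 4 * ω ^ 2)⁻¹) + (1 / 4 - lam / 4 * (1 + 4 * ω ^ 2)⁻¹) = 1 / 2 ∧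
      lam * ω / 2 * (1 + 4 * ω ^ 2)⁻¹ =
        ω * ((1 / 4 + lam / 4 * (1 + 4 * ω ^ 2)⁻¹) - (1 / 4 - lam / 4 * (1 + 4 * ω ^ 2)⁻¹)) ∧
      4 * ((1 / 4 + lam / 4 * (1 + 4 * ω ^ 2)⁻¹) ^ 2 + (lam * ω / 2 * (1 + 4 * ω ^ 2)⁻¹) ^ 2) =
        (1 + lam) * (1 / 4 + lam / 4 * (1 + 4 * ω ^ 2)⁻¹) -
          2 * ω * (lam * ω / 2 * (1 + 4 * ω ^ 2)⁻¹) ∧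
      4 * ((lam * ω / 2 * (1 + 4 * ω ^ 2)⁻¹) ^ 2 + (1 / 4 - lam / 4 * (1 + 4 * ω ^ 2)⁻¹) ^ 2) =
        (1 - lam) * (1 / 4 - lam / 4 * (1 + 4 * ω ^ 2)⁻¹) +
          2 * ω * (lam * ω / 2 * (1 + 4 * ω ^ 2)⁻¹) := by
  have hω : (1 : ℝ) + 4 * ω ^ 2 ≠ 0 := by positivity
  have hX : (1 + 4 * ω ^ 2)⁻¹ * (1 + 4 * ω ^ 2) = (1 : ℝ) := inv_mul_cancel₀ hω
  refine ⟨by ring, by ring, ?_, ?_⟩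
  · linear_combination (lam / 4 + lam ^ 2 * (1 + 4 * ω ^ 2)⁻¹ / 4) * hX
  · linear_combination (lam ^ 2 * (1 + 4 * ω ^ 2)⁻¹ / 4 - lam / 4) * hX

/-- **Tilt.**  The steady core Gaussian of `L_λ − ω∂_θ` is axis-aligned (`r = 0`) iff `λω = 0`: with ambient
rotation (`ω ≠ 0`, i.e. a non-horizontal filament) and asymmetric strain (`λ ≠ 0`) it is TILTED against the
strain axes. [folklore] -/
theorem gaussianCoreRot_untilted_iff {lam ω p r s : ℝ}
    (h : p + s = 1 / 2 ∧ r = ω * (p - s) ∧ 4 * (p ^ 2 + r ^ 2) = (1 + lam) * p - 2 * ω * r ∧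
      4 * (r ^ 2 + s ^ 2) = (1 - lam) * s + 2 * ω * r) :
    r = 0 ↔ lam * ω = 0 := by
  obtain ⟨-, -, hr⟩ := gaussianCoreRot_unique h
  have hω : (0 : ℝ) < 1 + 4 * ω ^ 2 := by positivity
  have hc : (1 + 4 * ω ^ 2)⁻¹ ≠ (0 : ℝ) := inv_ne_zero hω.ne'
  rw [hr]
  constructor
  · intro h0
    rcases mul_eq_zero.1 h0 with h1 | h1
    · linarith
    · exact absurd h1 hc
  · intro h0
    rw [show lam * ω / 2 * (1 + 4 * ω ^ 2)⁻¹ = lam * ω * ((1 + 4 * ω ^ 2)⁻¹ / 2) by ring, h0,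
      zero_mul]

/-- **A tilted Gaussian is never a steady state of the hypothesis' operator `L_λ`** (the case `ω = 0` of the
classification forces `r = 0`).  So at every filament with `λ ≠ 0` and `⟨t,e₃⟩ ≠ 0` the `R = 0` core of the
true local operator is not the object `CoreLinearInvertibility` linearises around. [folklore] -/
theorem not_steady_strainedVorticityOperator_of_tilted {lam p r s k : ℝ} (hk : k ≠ 0) (hr : r ≠ 0) :
    ¬ ∀ x : EuclideanSpace ℝ (Fin 2),
      strainedVorticityOperator lam (fun y : EuclideanSpace ℝ (Fin 2) =>
        k * Real.exp (-(p * y 0 ^ 2 + 2 * r * (y 0 * y 1) + s * y 1 ^ 2))) x = 0 := by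
  intro h
  have h' : ∀ x : EuclideanSpace ℝ (Fin 2),
      strainedVorticityOperator lam (fun y : EuclideanSpace ℝ (Fin 2) =>
          k * Real.exp (-(p * y 0 ^ 2 + 2 * r * (y 0 * y 1) + s * y 1 ^ 2))) x -
        0 * (x 0 * fderiv ℝ (fun y : EuclideanSpace ℝ (Fin 2) =>
            k * Real.exp (-(p * y 0 ^ 2 + 2 * r * (y 0 * y 1) + s * y 1 ^ 2))) x
              (EuclideanSpace.single 1 (1 : ℝ)) -
          x 1 * fderiv ℝ (fun y : EuclideanSpace ℝ (Fin 2) =>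
            k * Real.exp (-(p * y 0 ^ 2 + 2 * r * (y 0 * y 1) + s * y 1 ^ 2))) x
              (EuclideanSpace.single 0 (1 : ℝ))) = 0 := fun x => by
    rw [zero_mul, sub_zero]; exact h x
  obtain ⟨-, hC, -⟩ := (rotStrainedOp_expNegQuadForm_eq_zero_iff hk).1 h'
  exact hr (by rw [hC]; ring)

/-- **Determinant of the core Gaussian: the Hurwitz criterion in closed form.**  For the unique steady
Gaussian of `L_λ − ω∂_θ`, `ps − r² = (1 − λ²(1+4ω²)⁻¹)/16 = (1 + 4ω² − λ²)/(16(1 + 4ω²))`. [folklore] -/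
theorem gaussianCoreRot_det {lam ω p r s : ℝ}
    (h : p + s = 1 / 2 ∧ r = ω * (p - s) ∧ 4 * (p ^ 2 + r ^ 2) = (1 + lam) * p - 2 * ω * r ∧
      4 * (r ^ 2 + s ^ 2) = (1 - lam) * s + 2 * ω * r) :
    p * s - r ^ 2 = (1 - lam ^ 2 * (1 + 4 * ω ^ 2)⁻¹) / 16 := by
  obtain ⟨hp, hs, hr⟩ := gaussianCoreRot_unique h
  have hω : (1 : ℝ) + 4 * ω ^ 2 ≠ 0 := by positivity
  have hX : (1 + 4 * ω ^ 2)⁻¹ * (1 + 4 * ω ^ 2) = (1 : ℝ) := inv_mul_cancel₀ hω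
  rw [hp, hs, hr]
  linear_combination (-(lam ^ 2 * (1 + 4 * ω ^ 2)⁻¹ / 16)) * hX

/-- **A Gaussian core decaying in every cross direction exists iff `λ² < 1 + 4ω²`.**  The steady Gaussian
`e^{−(p x₀² + 2r x₀x₁ + s x₁²)}` of `L_λ − ω∂_θ` has positive definite exponent (`0 < p`, `0 < ps − r²`) iff
`λ² < 1 + 4ω²` — the parent lead's Hurwitz criterion `det A⊥ > 0`; at `ω = 0` (the hypothesis' operator)
this is the elliptic window `|λ| < 1`, which the frame rotation widens to `|λ| < √(1 + 4ω²)`. [folklore] -/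
theorem gaussianCoreRot_decaying_iff {lam ω p r s : ℝ}
    (h : p + s = 1 / 2 ∧ r = ω * (p - s) ∧ 4 * (p ^ 2 + r ^ 2) = (1 + lam) * p - 2 * ω * r ∧
      4 * (r ^ 2 + s ^ 2) = (1 - lam) * s + 2 * ω * r) :
    (0 < p ∧ 0 < p * s - r ^ 2) ↔ lam ^ 2 < 1 + 4 * ω ^ 2 := by
  have hdet := gaussianCoreRot_det h
  have hω : (0 : ℝ) < 1 + 4 * ω ^ 2 := by positivity
  have hc : (0 : ℝ) < (1 + 4 * ω ^ 2)⁻¹ := inv_pos.2 hω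
  have hX : (1 + 4 * ω ^ 2)⁻¹ * (1 + 4 * ω ^ 2) = (1 : ℝ) := inv_mul_cancel₀ hω.ne'
  -- `16 (ps − r²) (1+4ω²) = 1 + 4ω² − λ²`
  have key : 16 * (p * s - r ^ 2) * (1 + 4 * ω ^ 2) = 1 + 4 * ω ^ 2 - lam ^ 2 := by
    rw [hdet]
    linear_combination (-(lam ^ 2)) * hX
  constructor
  · rintro ⟨-, hd⟩
    nlinarith
  · intro hl
    have hdpos : 0 < p * s - r ^ 2 := by
      by_contra h0
      have h0' : p * s - r ^ 2 ≤ 0 := not_lt.1 h0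
      nlinarith
    refine ⟨?_, hdpos⟩
    -- `p > 0`: from `p + s = ½` and `ps > r² ≥ 0`, both `p, s` are positive
    by_contra hp0
    have hp0' : p ≤ 0 := not_lt.1 hp0
    have hps : 0 < p * s := by nlinarith [sq_nonneg r]
    have hs0 : s < 0 := by
      by_contra hs0
      have hs0' : 0 ≤ s := not_lt.1 hs0
      nlinarith
    obtain ⟨hT, -⟩ := h
    linarith

/-- **Worked instances** (exact rationals).  At asymmetry `λ = 6/5 > 1` (hyperbolic symmetric strain) the
ambient rotation `ω = 2/5` restores a decaying (tilted) Gaussian core (`λ² = 36/25 < 41/25 = 1 + 4ω²`), while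
`ω = 3/10` does not (`1 + 4ω² = 34/25 < 36/25`) — cf. the sibling `C₄` datum of stmt-15400, `λ ≈ 1.17`,
`ω ≈ 0.29`, `det A⊥ = −0.022` (lead c2 of stmt-15401); and with `ω = 0` (the hypothesis' operator) no
`λ ≥ 1` is ever admissible. [folklore] -/
theorem gaussianCoreRot_examples :
    ((6 / 5 : ℝ) ^ 2 < 1 + 4 * (2 / 5 : ℝ) ^ 2) ∧ ¬ ((6 / 5 : ℝ) ^ 2 < 1 + 4 * (3 / 10 : ℝ) ^ 2) ∧
      ∀ lam : ℝ, 1 ≤ lam → ¬ (lam ^ 2 < 1 + 4 * (0 : ℝ) ^ 2) := by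
  refine ⟨by norm_num, by norm_num, fun lam hl h => ?_⟩
  nlinarith

end Summit.NavierStokesRegularity.NavierStokesRegularity.Theorems.CoreGluingGivenInvertibility.Negative
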